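import Summits.CriticalPhenomena.PercolationContinuityZ3.Theorems.PercNearOneGluingNoHeavyLowerTailKnDesignationTwoRelays
import HarnessLib

/-!
# The Σ-form of Kozma–Nitzan's (41) for EVERY relay set under every pocket-restricted designation:
# `μ(c↔b, o↔A) ≤ Σ_{x ∈ A} μ(o↔b, o↔x)` for the Question-8 / Question-9 / cut designees `c`

Helper for crux `PercNearOneGluingNoHeavy.NoHeavyLowerTail` (item stmt-CriticalPhenomena-4575, closed), lemma factory
prim-lf-2 (deletion–contraction), gen 14.  No definitions, no named facts, no sorries; standard axioms.

The pre-FKG inequality (41) of arXiv:2401.12397 at an observer `o` for a relay `c ∈ A` reads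
`μ({c↔b} ∩ {o↔A}) ≤ μ({o↔b} ∩ {o↔A})`, `{o↔A} = ⋃_{x∈A} {o↔x}`.  For two relays the tree now proves it for the designee of
every pocket-restricted score `μ({·↔b} ∩ D)`, `D = {C_o ∈ 𝒟}` a decreasing pocket event (`KnQ8.block41_pair_of_downEvent`,
p211396: Questions 7, 8, 9 and all cuts at `|A| = 2`).  For `|A| ≥ 3` the same two-relay mechanism does not give (41) (its
output is the restricted pairwise comparison of the no-go RQ7, seat memo §0(4)), but it gives (41) RELAY BY RELAY on the
pieces `{o↔x} ∖ {o↔c}` of the observer event, hence the union-bound ("Σ") form of (41):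

* `KnQ8.piece_of_downEvent` — for `x ≠ c`, `o ≠ c`, `𝒟` down-closed with `c ∉ S` (`S ∈ 𝒟`): if `μ({c↔b}∩D) ≤ μ({x↔b}∩D)` and
  `μ({c↮x}∩{c↮o}∩D) > 0` then `μ({c↔b} ∩ {o↔x} ∖ {o↔c}) ≤ μ({o↔b} ∩ {o↔x} ∖ {o↔c})` (steps (0)–(3) of the two-relay
  proof: `rbhk_neg`, `OffCluster.offCluster_event_negCorr`, `knLemma3i_restricted`).
* `KnQ8.sigma41_of_downEvent` — **for every finite weighted graph, every relay set `A ∋ c`, every decreasing pocket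
  event `D` missing `c`: if `c` minimises `μ({·↔b} ∩ D)` over `A` (and the pairwise positive masses hold) then
  `μ({c↔b} ∩ {o↔A}) ≤ Σ_{x∈A} μ({o↔b} ∩ {o↔x})`** — (41) with the union on the right-hand side replaced by the sum; for
  `|A| = 2` the piece form is (41) itself.  `KnQ8.sigma41_of_avoid_lt_one` — the `T`-family without weight-`1` pairs
  (`D = {o↮T}`, `c ∈ T ∌ o`): `T = A` is the Question-8 designee, `T = {o}ᶜ` the Question-9 designee (`{o isolated}`), every
  vertex cut `T` between `o` and `A` an interpolating one — the first statements about these designees for `|A| ≥ 3` on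
  arbitrary finite graphs (the exact census of the seat memo, ≈ 1.5 M designated instances with `n ≤ 10`, finds (41) itself
  with 0 violations for all of them: conjecture MC-D).
[cite: KozmaNitzan2024, Questions 7–9 (§5.5 p. 36), display (41), Lemma 3 (pp. 6–7)]
[cite: VandenbergHaggstromKahn2005, Thms. 1.3–1.5 (pp. 6–8)]
-/

noncomputable section

namespace Summit.CriticalPhenomena.PercolationContinuityZ3.Theorems

open MeasureTheory Set
open Literature.Probability.LatticeModels (prodBernoulli)
open Literature.Probability.Percolation
open scoped Classical

namespace KnQ8

variable {V : Type*} [Fintype V]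

/-- **One piece of (41).**  `x ≠ c`, `o ≠ c`, `𝒟` down-closed with `c ∉ S` for `S ∈ 𝒟`, `D = {C_o ∈ 𝒟}`: if
`μ({c↔b} ∩ D) ≤ μ({x↔b} ∩ D)` and `μ({c↮x} ∩ {c↮o} ∩ D) > 0` then
`μ({c↔b} ∩ {o↔x} ∩ {o↔c}ᶜ) ≤ μ({o↔b} ∩ {o↔x} ∩ {o↔c}ᶜ)`.
[cite: KozmaNitzan2024, display (41) (p. 36), Lemma 3 (pp. 6–7)] [cite: VandenbergHaggstromKahn2005, Thms. 1.3–1.5 (pp. 6–8)] -/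
theorem piece_of_downEvent (w : Sym2 V → unitInterval) (o b x c : V) (hxc : x ≠ c) (hoc : o ≠ c)
    (𝒟 : Set (Set V)) (h𝒟 : ∀ S S' : Set V, S ⊆ S' → S' ∈ 𝒟 → S ∈ 𝒟) (hc𝒟 : ∀ S ∈ 𝒟, c ∉ S)
    (hmin : (prodBernoulli w).real (openConn c b ∩ {ω | openCluster ω o ∈ 𝒟}) ≤
      (prodBernoulli w).real (openConn x b ∩ {ω | openCluster ω o ∈ 𝒟}))
    (hpos : 0 < (prodBernoulli w).real
      ({ω : BondConfig V | ¬ (openGraph ω).Reachable c x} ∩ {ω | ¬ (openGraph ω).Reachable c o} ∩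
        {ω | openCluster ω o ∈ 𝒟})) :
    (prodBernoulli w).real (openConn c b ∩ openConn o x ∩ (openConn o c)ᶜ) ≤
      (prodBernoulli w).real (openConn o b ∩ openConn o x ∩ (openConn o c)ᶜ) := by
  set μ := prodBernoulli w with hμ
  set X : Set V := {x, o} with hX
  set N : Set (BondConfig V) := {ω | ∀ y ∈ X, ¬ (openGraph ω).Reachable c y} with hN
  set D : Set (BondConfig V) := {ω | openCluster ω o ∈ 𝒟} with hD
  have hNiff : ∀ ω : BondConfig V, ω ∈ N ↔ ¬ (openGraph ω).Reachable c x ∧ ¬ (openGraph ω).Reachable c o := by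
    intro ω
    simp only [hN, hX, mem_setOf_eq, mem_insert_iff, mem_singleton_iff, forall_eq_or_imp, forall_eq]
  have hDoc : ∀ ω : BondConfig V, ω ∈ D → ¬ (openGraph ω).Reachable c o := by
    intro ω hω h
    exact hc𝒟 _ hω (show c ∈ openCluster ω o from h.symm)
  -- (0) restrict the hypothesis to `N`
  have hmC : MeasurableSet (openConn c x : Set (BondConfig V)) := MeasurableSet.of_discrete
  have hsplit : ∀ E : Set (BondConfig V),
      μ.real (E ∩ D) = μ.real (E ∩ D ∩ openConn c x) + μ.real ((E ∩ D) \ openConn c x) := by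
    intro E; rw [measureReal_inter_add_sdiff (s := E ∩ D) hmC]
  have f1 : (openConn c b : Set (BondConfig V)) ∩ D ∩ openConn c x = openConn x b ∩ D ∩ openConn c x := by
    ext ω
    simp only [mem_inter_iff, openConn, mem_setOf_eq]
    constructor
    · rintro ⟨⟨hcb, hd⟩, hcx⟩; exact ⟨⟨hcx.symm.trans hcb, hd⟩, hcx⟩
    · rintro ⟨⟨hxb, hd⟩, hcx⟩; exact ⟨⟨hcx.trans hxb, hd⟩, hcx⟩
  have f2 : ∀ y : V, ((openConn y b : Set (BondConfig V)) ∩ D) \ openConn c x = N ∩ D ∩ openConn y b := by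
    intro y; ext ω
    simp only [mem_inter_iff, mem_sdiff, hNiff, openConn, mem_setOf_eq]
    constructor
    · rintro ⟨⟨hyb, hd⟩, hncx⟩; exact ⟨⟨⟨hncx, hDoc ω hd⟩, hd⟩, hyb⟩
    · rintro ⟨⟨⟨hncx, -⟩, hd⟩, hyb⟩; exact ⟨⟨hyb, hd⟩, hncx⟩
  have hle : μ.real (N ∩ D ∩ openConn c b) ≤ μ.real (N ∩ D ∩ openConn x b) := by
    have h := hmin
    rw [hsplit (openConn c b), hsplit (openConn x b), f1, f2 c, f2 x] at h
    linarith
  have hpos' : 0 < μ.real (N ∩ D) := by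
    have e : N ∩ D = {ω : BondConfig V | ¬ (openGraph ω).Reachable c x} ∩ {ω | ¬ (openGraph ω).Reachable c o} ∩ D := by
      ext ω; simp only [mem_inter_iff, hNiff, mem_setOf_eq, and_assoc]
    rw [e]; exact hpos
  -- (1)+(2): the comparison on all of `N`
  have hNle := restricted_le_of_le_on_downEvent w o x b c hxc hoc 𝒟 h𝒟 hpos' hle
  -- (3): transfer onto `N ∩ {x ↔ o}`
  have hcX : c ∉ X := by
    simp only [hX, mem_insert_iff, mem_singleton_iff, not_or]
    exact ⟨fun h => hxc h.symm, fun h => hoc h.symm⟩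
  have step := knLemma3i_restricted w c x b X hcX (fun h => hxc h.symm) (openConn x o) 0
    (openConn_mono_openEdgeCluster x o) le_rfl (by rw [add_zero]; exact hNle)
  rw [add_zero] at step
  -- identify the piece events
  have e1 : N ∩ openConn c b ∩ openConn x o = openConn c b ∩ openConn o x ∩ (openConn o c)ᶜ := by
    ext ω
    simp only [mem_inter_iff, mem_compl_iff, hNiff, openConn, mem_setOf_eq]
    constructor
    · rintro ⟨⟨⟨-, hnco⟩, hcb⟩, hxo⟩; exact ⟨⟨hcb, hxo.symm⟩, fun h => hnco h.symm⟩
    · rintro ⟨⟨hcb, hox⟩, hnoc⟩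
      exact ⟨⟨⟨fun h => hnoc (hox.trans h.symm), fun h => hnoc h.symm⟩, hcb⟩, hox.symm⟩
  have e2 : N ∩ openConn x b ∩ openConn x o = openConn o b ∩ openConn o x ∩ (openConn o c)ᶜ := by
    ext ω
    simp only [mem_inter_iff, mem_compl_iff, hNiff, openConn, mem_setOf_eq]
    constructor
    · rintro ⟨⟨⟨-, hnco⟩, hxb⟩, hxo⟩; exact ⟨⟨hxo.symm.trans hxb, hxo.symm⟩, fun h => hnco h.symm⟩
    · rintro ⟨⟨hob, hox⟩, hnoc⟩
      exact ⟨⟨⟨fun h => hnoc (hox.trans h.symm), fun h => hnoc h.symm⟩, hox.symm.trans hob⟩, hox.symm⟩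
  rw [e1, e2] at step
  exact step

/-- **The Σ-form of (41) for every relay set under every pocket-restricted designation.**  `A` a finite relay set,
`c ∈ A`, `o ∉ A`, `𝒟` down-closed with `c ∉ S` for `S ∈ 𝒟`, `D = {C_o ∈ 𝒟}`.  If `μ({c↔b} ∩ D) ≤ μ({x↔b} ∩ D)` for every
`x ∈ A` and `μ({c↮x} ∩ {c↮o} ∩ D) > 0` for every `x ∈ A ∖ {c}`, then
`μ({c↔b} ∩ {o↔A}) ≤ Σ_{x ∈ A} μ({o↔b} ∩ {o↔x})`.
(Union bound over `{o↔A} ⊆ {o↔c} ∪ ⋃_{x ≠ c} ({o↔x} ∖ {o↔c})`, the piece inequality on each `x ≠ c`, and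
`{c↔b} ∩ {o↔c} = {o↔b} ∩ {o↔c}`.) [cite: KozmaNitzan2024, Questions 7–9 (§5.5 p. 36), display (41)]
[cite: VandenbergHaggstromKahn2005, Thms. 1.3–1.5 (pp. 6–8)] -/
theorem sigma41_of_downEvent (w : Sym2 V → unitInterval) (A : Finset V) (o b c : V) (hcA : c ∈ A) (hoA : o ∉ A)
    (𝒟 : Set (Set V)) (h𝒟 : ∀ S S' : Set V, S ⊆ S' → S' ∈ 𝒟 → S ∈ 𝒟) (hc𝒟 : ∀ S ∈ 𝒟, c ∉ S)
    (hmin : ∀ x ∈ A, (prodBernoulli w).real (openConn c b ∩ {ω | openCluster ω o ∈ 𝒟}) ≤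
      (prodBernoulli w).real (openConn x b ∩ {ω | openCluster ω o ∈ 𝒟}))
    (hpos : ∀ x ∈ A, x ≠ c → 0 < (prodBernoulli w).real
      ({ω : BondConfig V | ¬ (openGraph ω).Reachable c x} ∩ {ω | ¬ (openGraph ω).Reachable c o} ∩
        {ω | openCluster ω o ∈ 𝒟})) :
    (prodBernoulli w).real (openConn c b ∩ ⋃ x ∈ A, openConn o x) ≤
      ∑ x ∈ A, (prodBernoulli w).real (openConn o b ∩ openConn o x) := by
  set μ := prodBernoulli w with hμ
  have hoc : o ≠ c := fun h => hoA (h ▸ hcA)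
  -- decomposition of the observer event
  have hsub : (openConn c b ∩ ⋃ x ∈ A, openConn o x : Set (BondConfig V)) ⊆
      (openConn c b ∩ openConn o c) ∪ ⋃ x ∈ A.erase c, (openConn c b ∩ openConn o x ∩ (openConn o c)ᶜ) := by
    rintro ω ⟨hcb, hU⟩
    simp only [mem_iUnion, exists_prop] at hU
    obtain ⟨x, hxA, hox⟩ := hU
    by_cases hocω : ω ∈ (openConn o c : Set (BondConfig V))
    · exact Or.inl ⟨hcb, hocω⟩
    · refine Or.inr ?_
      simp only [mem_iUnion, exists_prop, Finset.mem_erase]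
      have hxc : x ≠ c := by rintro rfl; exact hocω hox
      exact ⟨x, ⟨hxc, hxA⟩, ⟨hcb, hox⟩, hocω⟩
  have h1 : μ.real (openConn c b ∩ ⋃ x ∈ A, openConn o x) ≤
      μ.real (openConn c b ∩ openConn o c) +
        ∑ x ∈ A.erase c, μ.real (openConn c b ∩ openConn o x ∩ (openConn o c)ᶜ) :=
    (measureReal_mono hsub).trans ((measureReal_union_le _ _).trans
      (add_le_add le_rfl (measureReal_biUnion_finset_le _ _)))
  -- the `c`-piece is common to both sides
  have e0 : (openConn c b ∩ openConn o c : Set (BondConfig V)) = openConn o b ∩ openConn o c := by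
    ext ω
    simp only [mem_inter_iff, openConn, mem_setOf_eq]
    constructor
    · rintro ⟨hcb, hoc'⟩; exact ⟨hoc'.trans hcb, hoc'⟩
    · rintro ⟨hob, hoc'⟩; exact ⟨hoc'.symm.trans hob, hoc'⟩
  -- the other pieces
  have h2 : ∀ x ∈ A.erase c, μ.real (openConn c b ∩ openConn o x ∩ (openConn o c)ᶜ) ≤ μ.real (openConn o b ∩ openConn o x) := by
    intro x hx
    have hxc : x ≠ c := (Finset.mem_erase.1 hx).1
    have hxA : x ∈ A := (Finset.mem_erase.1 hx).2
    exact (piece_of_downEvent w o b x c hxc hoc 𝒟 h𝒟 hc𝒟 (hmin x hxA) (hpos x hxA hxc)).trans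
      (measureReal_mono inter_subset_left)
  calc μ.real (openConn c b ∩ ⋃ x ∈ A, openConn o x)
      ≤ μ.real (openConn c b ∩ openConn o c) +
          ∑ x ∈ A.erase c, μ.real (openConn c b ∩ openConn o x ∩ (openConn o c)ᶜ) := h1
    _ ≤ μ.real (openConn o b ∩ openConn o c) + ∑ x ∈ A.erase c, μ.real (openConn o b ∩ openConn o x) := by
          rw [e0]; exact add_le_add le_rfl (Finset.sum_le_sum h2)
    _ = ∑ x ∈ A, μ.real (openConn o b ∩ openConn o x) :=
          Finset.add_sum_erase A (fun x => μ.real (openConn o b ∩ openConn o x)) hcA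

/-- **The Σ-form for the `T`-family without weight-`1` pairs.**  `A` finite, `c ∈ A`, `o ∉ A`, `T ∋ c` with `o ∉ T`, all
weights `< 1`: if `c` minimises `μ({·↔b} ∩ {o↮T})` over `A` then `μ({c↔b} ∩ {o↔A}) ≤ Σ_{x∈A} μ({o↔b} ∩ {o↔x})`.
`T = A`: the Question-8 designee; `T = {o}ᶜ`: the Question-9 designee; `T` any vertex cut between `o` and `A`.
[cite: KozmaNitzan2024, Questions 8–9 (§5.5 p. 36), display (41)] -/
theorem sigma41_of_avoid_lt_one (w : Sym2 V → unitInterval) (hw : ∀ e, w e < 1) (A : Finset V) (o b c : V)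
    (hcA : c ∈ A) (hoA : o ∉ A) (T : Set V) (hcT : c ∈ T) (hoT : o ∉ T)
    (hmin : ∀ x ∈ A, (prodBernoulli w).real (openConn c b ∩ {ω | ∀ t ∈ T, ¬ (openGraph ω).Reachable o t}) ≤
      (prodBernoulli w).real (openConn x b ∩ {ω | ∀ t ∈ T, ¬ (openGraph ω).Reachable o t})) :
    (prodBernoulli w).real (openConn c b ∩ ⋃ x ∈ A, openConn o x) ≤
      ∑ x ∈ A, (prodBernoulli w).real (openConn o b ∩ openConn o x) := by
  set 𝒟 : Set (Set V) := {S | ∀ t ∈ T, t ∉ S} with h𝒟def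
  have eD : {ω : BondConfig V | openCluster ω o ∈ 𝒟} = {ω | ∀ t ∈ T, ¬ (openGraph ω).Reachable o t} := by
    ext ω; simp only [mem_setOf_eq, h𝒟def, openCluster]
  have h𝒟 : ∀ S S' : Set V, S ⊆ S' → S' ∈ 𝒟 → S ∈ 𝒟 := fun S S' hSS' hS' t ht hts => hS' t ht (hSS' hts)
  have hc𝒟 : ∀ S ∈ 𝒟, c ∉ S := fun S hS hcS => hS c hcT hcS
  have hoc : o ≠ c := fun h => hoA (h ▸ hcA)
  refine sigma41_of_downEvent w A o b c hcA hoA 𝒟 h𝒟 hc𝒟 (fun x hx => by rw [eD]; exact hmin x hx) ?_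
  intro x _ hxc
  rw [eD]
  refine real_pos_of_empty_mem w hw ?_
  simp only [mem_inter_iff, mem_setOf_eq, reachable_empty_iff]
  exact ⟨⟨fun h => hxc h.symm, fun h => hoc h.symm⟩, fun t ht h => hoT (h ▸ ht)⟩

end KnQ8

end Summit.CriticalPhenomena.PercolationContinuityZ3.Theorems

end
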